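import Summits.SmoothPoincare4.SmoothPoincare4.Theorems.ConvexBisectionAcyclicBisectionExistsOrseamPageFrame
import Literature.Geometry.Symplectic.PuncturedDiscClosedOneForm
import Literature.Topology.FourManifolds.CircleTubeTransition
import HarnessLib

/-!
# Hgap ▸ part B, transfer step (R6c), tube side III: the polar flip `(m, φ) ↦ (‖m‖ e^{2πiφ}, arg m / 2π)`
# of `ℝ³` has Jacobian determinant `-1`
(wave 7, crux stmt-SmoothPoincare4-10508, line `modp-braid-orbits`, stub `stub_T3_dualPresentation` (T3)
▸ HB = `helper_Hgap_twisting` ▸ (R6c); registered sub-goal `helper_det4_polarFlip`)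

H1's tube-side map of the transfer (`work/stubs/H1H2H3_interface.lean`, G2-REPORT §4 (R6b)) is
`η̂ (p) = f♭ (e^{2πiψ(L p)}, ‖L p‖ e^{2πi p₂})`, `ψ (m) = arg (m₀ + i m₁) / 2π`, i.e. `η♯ = F ∘ flip` with `F` the
attaching-tube chart of `…HgapCharTubeChart.lean` and the POLAR FLIP of `ℝ³`

  `flip (p) = (‖L p‖ cos 2πp₂, ‖L p‖ sin 2πp₂, arg (toC (L p)) / 2π)`   (`L p = (p₀, p₁)` the fibre part),

which exchanges the roles of core angle and fibre direction (Kosinski's handle inversion near the belt circle,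
G2 `coe_belt_boundaryTube_polar`).  This file is the flat calculus of `flip`:

* §1 the angle `ψ = arg ∘ toC / 2π` is differentiable off the closed negative real axis with
  `dψ_m (v) = (m₀ v₁ - m₁ v₀) / (2π (m₀² + m₁²))` (`hasFDerivAt_argToC`, `argToC_fderiv_apply`);
* §2 the derivative `J = D flip (p)` (`hasFDerivAt_polarFlip`), written column-wise on the standard basis;
* §3 **`det J = -1`**: for every map `F : ℝ³ → ℝ⁴` differentiable at `flip p` and every `N ∈ ℝ⁴`,
  `det4 (N, ∂₀(F ∘ flip), ∂₁(F ∘ flip), ∂₂(F ∘ flip)) (p) = - det4 (N, ∂₀F, ∂₁F, ∂₂F) (flip p)`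
  (`det4_fderiv_comp_polarFlip`, registered as `helper_det4_polarFlip`; chain rule + X4's recombination rule
  `det4_lincomb₃` + the `3 × 3` determinant `-(cos² + sin²)(m₀² + m₁²)/‖m‖² = -1`).

So the orientation character of `η♯` at `p` is MINUS that of the attaching-tube chart at `flip p` — the
`or(flip) = -1` of G2's sign table.  Everything is proved; no named facts, no `sorry`.  References:
A. A. Kosinski, *Differential Manifolds* (1993), VI §6 (6.1) [Kosinski1993].
-/

noncomputable section

set_option linter.dupNamespace false

open scoped Topology RealInnerProductSpace Real
open Set Function Metric Filter Complex

namespace Summit.SmoothPoincare4.SmoothPoincare4.Theorems.AcyclicBisectionExists.ModpBraidOrbits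

open Literature.Topology.FourManifolds Literature.Geometry.Symplectic

/-! ## §1 The angle `ψ (m) = arg (m₀ + i m₁) / 2π` and its derivative -/

/-- `toC : ℝ² → ℂ` is (real-)linear: it has derivative the isometry `ℝ² ≃ ℂ` of the basis `(1, i)` everywhere.
[folklore] -/
theorem hasFDerivAt_toC (m : EuclideanSpace ℝ (Fin 2)) :
    HasFDerivAt toC (Complex.orthonormalBasisOneI.repr.symm.toContinuousLinearEquiv :
      EuclideanSpace ℝ (Fin 2) →L[ℝ] ℂ) m := by
  have h := (Complex.orthonormalBasisOneI.repr.symm.toContinuousLinearEquiv).hasFDerivAt (x := m)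
  refine h.congr_of_eventuallyEq (Eventually.of_forall fun v => ?_)
  exact toC_eq_orthonormalBasisOneI_repr_symm v

/-- The isometry `ℝ² ≃ ℂ` of the basis `(1, i)` is `toC`. [folklore] -/
theorem orthonormalBasisOneI_toCLM_apply (v : EuclideanSpace ℝ (Fin 2)) :
    (Complex.orthonormalBasisOneI.repr.symm.toContinuousLinearEquiv :
      EuclideanSpace ℝ (Fin 2) →L[ℝ] ℂ) v = toC v := by
  rw [toC_eq_orthonormalBasisOneI_repr_symm]; rfl

/-- **The angle `ψ (m) = arg (toC m) / 2π` is differentiable off the closed negative real axis**, with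
derivative `v ↦ Im ((toC m)⁻¹ toC v) / 2π`. [folklore] -/
theorem hasFDerivAt_argToC {m : EuclideanSpace ℝ (Fin 2)} (hm : toC m ∈ slitPlane) :
    HasFDerivAt (fun m : EuclideanSpace ℝ (Fin 2) => Complex.arg (toC m) / (2 * Real.pi))
      ((2 * Real.pi)⁻¹ • ((Complex.imCLM.comp ((toC m)⁻¹ • (1 : ℂ →L[ℝ] ℂ))).comp
        (Complex.orthonormalBasisOneI.repr.symm.toContinuousLinearEquiv : EuclideanSpace ℝ (Fin 2) →L[ℝ] ℂ))) m := by
  have h1 := (hasFDerivAt_arg hm).comp m (hasFDerivAt_toC m)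
  have h2 := h1.mul_const (2 * Real.pi)⁻¹
  have e : (fun m : EuclideanSpace ℝ (Fin 2) => Complex.arg (toC m) / (2 * Real.pi)) =
      fun m => Complex.arg (toC m) * (2 * Real.pi)⁻¹ := funext fun _ => div_eq_mul_inv _ _
  rw [e]
  exact h2

/-- **The derivative of the angle in coordinates**: `dψ_m (v) = (m₀ v₁ - m₁ v₀) / (2π (m₀² + m₁²))`.
[folklore] -/
theorem argToC_fderiv_apply (m v : EuclideanSpace ℝ (Fin 2)) :
    ((2 * Real.pi)⁻¹ • ((Complex.imCLM.comp ((toC m)⁻¹ • (1 : ℂ →L[ℝ] ℂ))).comp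
        (Complex.orthonormalBasisOneI.repr.symm.toContinuousLinearEquiv : EuclideanSpace ℝ (Fin 2) →L[ℝ] ℂ))) v =
      (m 0 * v 1 - m 1 * v 0) / (2 * Real.pi * (m 0 ^ 2 + m 1 ^ 2)) := by
  rw [_root_.smul_apply, ContinuousLinearMap.comp_apply, orthonormalBasisOneI_toCLM_apply,
    ContinuousLinearMap.comp_apply, _root_.smul_apply, one_apply_eq_self,
    Complex.imCLM_apply, smul_eq_mul, smul_eq_mul, Complex.mul_im, Complex.inv_re, Complex.inv_im,
    Complex.normSq_apply, toC_re, toC_im, toC_re, toC_im]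
  by_cases h : m 0 ^ 2 + m 1 ^ 2 = 0
  · have h0 : m 0 = 0 := by nlinarith [sq_nonneg (m 0), sq_nonneg (m 1)]
    have h1 : m 1 = 0 := by nlinarith [sq_nonneg (m 0), sq_nonneg (m 1)]
    simp [h0, h1]
  · have h' : m 0 * m 0 + m 1 * m 1 ≠ 0 := by rw [← sq, ← sq]; exact h
    field_simp
    ring

/-- **The `3 × 3` determinant of the polar flip is `-1`** (pure algebra: `c² + s² = 1`, `m₀² + m₁² = ρ²`).
[folklore] -/
theorem polarFlip_det (co si ρ m₀ m₁ : ℝ) (hρ : ρ ≠ 0) (hcs : co ^ 2 + si ^ 2 = 1) (hS : m₀ ^ 2 + m₁ ^ 2 = ρ ^ 2) :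
    co / ρ * m₀ * (si / ρ * m₁ * 0 - m₀ / (2 * Real.pi * ρ ^ 2) * (2 * Real.pi * ρ * co))
      - si / ρ * m₀ * (co / ρ * m₁ * 0 - m₀ / (2 * Real.pi * ρ ^ 2) * -(2 * Real.pi * ρ * si))
      + -m₁ / (2 * Real.pi * ρ ^ 2) * (co / ρ * m₁ * (2 * Real.pi * ρ * co) - si / ρ * m₁ * -(2 * Real.pi * ρ * si)) = -1 := by
  have hπ : Real.pi ≠ 0 := Real.pi_ne_zero
  have h1 : co / ρ * m₀ * (si / ρ * m₁ * 0 - m₀ / (2 * Real.pi * ρ ^ 2) * (2 * Real.pi * ρ * co))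
      - si / ρ * m₀ * (co / ρ * m₁ * 0 - m₀ / (2 * Real.pi * ρ ^ 2) * -(2 * Real.pi * ρ * si))
      + -m₁ / (2 * Real.pi * ρ ^ 2) * (co / ρ * m₁ * (2 * Real.pi * ρ * co) - si / ρ * m₁ * -(2 * Real.pi * ρ * si)) =
      -((co ^ 2 + si ^ 2) * (m₀ ^ 2 + m₁ ^ 2)) / ρ ^ 2 := by
    field_simp
    ring
  rw [h1, hcs, hS, one_mul, neg_div, div_self (pow_ne_zero 2 hρ)]

/-! ## §2 The derivative of the polar flip -/

section Flip

variable {L : EuclideanSpace ℝ (Fin 3) →L[ℝ] EuclideanSpace ℝ (Fin 2)}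
  (hL : ∀ (p : EuclideanSpace ℝ (Fin 3)) (i : Fin 2), L p i = p (Fin.castSucc i))

section Basis
include hL

/-- The fibre part of `e₀` is `e₀`. [folklore] -/
theorem lam_basis_zero : L (EuclideanSpace.single (0 : Fin 3) (1 : ℝ)) = planeE0 := by
  ext i; rw [hL]; fin_cases i <;> simp [planeE0]

/-- The fibre part of `e₁` is `e₁`. [folklore] -/
theorem lam_basis_one : L (EuclideanSpace.single (1 : Fin 3) (1 : ℝ)) = planeE1 := by
  ext i; rw [hL]; fin_cases i <;> simp [planeE1]

/-- The fibre part of `e₂` vanishes. [folklore] -/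
theorem lam_basis_two : L (EuclideanSpace.single (2 : Fin 3) (1 : ℝ)) = 0 := by
  ext i; rw [hL]; fin_cases i <;> simp

end Basis

/-- **The derivative of the polar flip** `flip (p) = (‖L p‖ cos 2πp₂, ‖L p‖ sin 2πp₂, arg (toC (L p)) / 2π)` at a
point whose fibre part is off the closed negative real axis, column-wise on the standard basis:
`J = (c/ρ ⟪m, L·⟫ - 2πρ s dp₂) ⊗ e₀ + (s/ρ ⟪m, L·⟫ + 2πρ c dp₂) ⊗ e₁ + (dψ ∘ L) ⊗ e₂`
(`m = L p`, `ρ = ‖m‖`, `c = cos 2πp₂`, `s = sin 2πp₂`). [cite: Kosinski1993, VI §6 (6.1)] -/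
theorem hasFDerivAt_polarFlip {p : EuclideanSpace ℝ (Fin 3)} (hm : toC (L p) ∈ slitPlane) :
    HasFDerivAt (fun p' : EuclideanSpace ℝ (Fin 3) => (!₂[‖L p'‖ * Real.cos (2 * Real.pi * p' 2),
        ‖L p'‖ * Real.sin (2 * Real.pi * p' 2), Complex.arg (toC (L p')) / (2 * Real.pi)] : EuclideanSpace ℝ (Fin 3)))
      (((Real.cos (2 * Real.pi * p 2) / ‖L p‖) • (innerSL ℝ (L p)).comp L -
            (2 * Real.pi * ‖L p‖ * Real.sin (2 * Real.pi * p 2)) • EuclideanSpace.proj (𝕜 := ℝ) (2 : Fin 3)).smulRight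
          (EuclideanSpace.single (0 : Fin 3) (1 : ℝ)) +
        ((Real.sin (2 * Real.pi * p 2) / ‖L p‖) • (innerSL ℝ (L p)).comp L +
            (2 * Real.pi * ‖L p‖ * Real.cos (2 * Real.pi * p 2)) • EuclideanSpace.proj (𝕜 := ℝ) (2 : Fin 3)).smulRight
          (EuclideanSpace.single (1 : Fin 3) (1 : ℝ)) +
        (((2 * Real.pi)⁻¹ • ((Complex.imCLM.comp ((toC (L p))⁻¹ • (1 : ℂ →L[ℝ] ℂ))).comp
          (Complex.orthonormalBasisOneI.repr.symm.toContinuousLinearEquiv : EuclideanSpace ℝ (Fin 2) →L[ℝ] ℂ))).comp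
            L).smulRight (EuclideanSpace.single (2 : Fin 3) (1 : ℝ))) p := by
  have hm0 : L p ≠ 0 := fun h0 => slitPlane_ne_zero hm (by rw [h0]; rfl)
  have hρ : 0 < ‖L p‖ := norm_pos_iff.2 hm0
  set ρ := ‖L p‖ with hρ_def
  set A : EuclideanSpace ℝ (Fin 3) →L[ℝ] ℝ := (innerSL ℝ (L p)).comp L with hA
  set P2 : EuclideanSpace ℝ (Fin 3) →L[ℝ] ℝ := EuclideanSpace.proj (𝕜 := ℝ) (2 : Fin 3) with hP2
  set Ψ : EuclideanSpace ℝ (Fin 2) →L[ℝ] ℝ := (2 * Real.pi)⁻¹ • ((Complex.imCLM.comp ((toC (L p))⁻¹ • (1 : ℂ →L[ℝ] ℂ))).comp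
    (Complex.orthonormalBasisOneI.repr.symm.toContinuousLinearEquiv : EuclideanSpace ℝ (Fin 2) →L[ℝ] ℂ)) with hΨ
  -- the norm of the fibre part
  have hn : HasFDerivAt (fun p' : EuclideanSpace ℝ (Fin 3) => ‖L p'‖) (ρ⁻¹ • A) p := by
    have h1 : HasFDerivAt (fun p' : EuclideanSpace ℝ (Fin 3) => ‖L p'‖ ^ 2) (2 • A) p := L.hasFDerivAt.norm_sq
    have h2 := h1.sqrt (by positivity : ‖L p‖ ^ 2 ≠ 0)
    have e1 : (fun p' : EuclideanSpace ℝ (Fin 3) => √(‖L p'‖ ^ 2)) = fun p' => ‖L p'‖ :=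
      funext fun p' => Real.sqrt_sq (norm_nonneg _)
    rw [e1] at h2
    refine h2.congr_fderiv ?_
    rw [Real.sqrt_sq hρ.le, two_smul, ← two_smul ℝ A, smul_smul]
    congr 1
    field_simp
  -- the angle coordinate
  have hP : HasFDerivAt (fun p' : EuclideanSpace ℝ (Fin 3) => 2 * Real.pi * p' 2) ((2 * Real.pi) • P2) p :=
    P2.hasFDerivAt.const_mul (2 * Real.pi)
  have hcos : HasFDerivAt (Real.cos ∘ fun p' : EuclideanSpace ℝ (Fin 3) => 2 * Real.pi * p' 2)
      ((-Real.sin (2 * Real.pi * p 2)) • ((2 * Real.pi) • P2)) p :=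
    (Real.hasDerivAt_cos (2 * Real.pi * p 2)).comp_hasFDerivAt p hP
  have hsin : HasFDerivAt (Real.sin ∘ fun p' : EuclideanSpace ℝ (Fin 3) => 2 * Real.pi * p' 2)
      ((Real.cos (2 * Real.pi * p 2)) • ((2 * Real.pi) • P2)) p :=
    (Real.hasDerivAt_sin (2 * Real.pi * p 2)).comp_hasFDerivAt p hP
  have hψ : HasFDerivAt (fun p' : EuclideanSpace ℝ (Fin 3) => Complex.arg (toC (L p')) / (2 * Real.pi)) (Ψ.comp L) p :=
    (hasFDerivAt_argToC hm).comp p L.hasFDerivAt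
  -- the three components
  have k0 : HasFDerivAt (fun p' : EuclideanSpace ℝ (Fin 3) => ‖L p'‖ * Real.cos (2 * Real.pi * p' 2))
      ((Real.cos (2 * Real.pi * p 2) / ρ) • A - (2 * Real.pi * ρ * Real.sin (2 * Real.pi * p 2)) • P2) p := by
    refine (hn.mul hcos).congr_fderiv ?_
    ext v
    simp only [_root_.add_apply, _root_.sub_apply, _root_.smul_apply, smul_eq_mul, Function.comp_apply, ← hρ_def]
    ring
  have k1 : HasFDerivAt (fun p' : EuclideanSpace ℝ (Fin 3) => ‖L p'‖ * Real.sin (2 * Real.pi * p' 2))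
      ((Real.sin (2 * Real.pi * p 2) / ρ) • A + (2 * Real.pi * ρ * Real.cos (2 * Real.pi * p 2)) • P2) p := by
    refine (hn.mul hsin).congr_fderiv ?_
    ext v
    simp only [_root_.add_apply, _root_.smul_apply, smul_eq_mul, Function.comp_apply, ← hρ_def]
    ring
  -- assemble
  refine hasFDerivWithinAt_univ.1 (hasFDerivWithinAt_euclidean.2 fun i => HasFDerivAt.hasFDerivWithinAt ?_)
  fin_cases i
  · have ef : (fun x : EuclideanSpace ℝ (Fin 3) => (!₂[‖L x‖ * Real.cos (2 * Real.pi * x 2),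
        ‖L x‖ * Real.sin (2 * Real.pi * x 2), Complex.arg (toC (L x)) / (2 * Real.pi)] : EuclideanSpace ℝ (Fin 3)) 0) =
        fun p' => ‖L p'‖ * Real.cos (2 * Real.pi * p' 2) := by
      funext x; simp
    simp only [Fin.zero_eta, Fin.isValue]
    rw [ef]
    refine k0.congr_fderiv ?_
    ext v
    simp
  · have ef : (fun x : EuclideanSpace ℝ (Fin 3) => (!₂[‖L x‖ * Real.cos (2 * Real.pi * x 2),
        ‖L x‖ * Real.sin (2 * Real.pi * x 2), Complex.arg (toC (L x)) / (2 * Real.pi)] : EuclideanSpace ℝ (Fin 3)) 1) =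
        fun p' => ‖L p'‖ * Real.sin (2 * Real.pi * p' 2) := by
      funext x; simp
    simp only [Fin.mk_one, Fin.isValue]
    rw [ef]
    refine k1.congr_fderiv ?_
    ext v
    simp
  · have ef : (fun x : EuclideanSpace ℝ (Fin 3) => (!₂[‖L x‖ * Real.cos (2 * Real.pi * x 2),
        ‖L x‖ * Real.sin (2 * Real.pi * x 2), Complex.arg (toC (L x)) / (2 * Real.pi)] : EuclideanSpace ℝ (Fin 3)) 2) =
        fun p' => Complex.arg (toC (L p')) / (2 * Real.pi) := by
      funext x; simp
    simp only [Fin.reduceFinMk, Fin.isValue]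
    rw [ef]
    refine hψ.congr_fderiv ?_
    ext v
    simp

/-! ## §3 `det D(flip) = -1`: the orientation character of `F ∘ flip` is minus that of `F` -/

include hL in
/-- **The polar flip reverses orientation: `det D(flip) = -1`.**  For every `F : ℝ³ → ℝ⁴` differentiable at
`flip p` (`p` with fibre part off the closed negative real axis) and every `N ∈ ℝ⁴`,
`det4 (N, ∂₀(F ∘ flip)(p), ∂₁(F ∘ flip)(p), ∂₂(F ∘ flip)(p)) = - det4 (N, ∂₀F, ∂₁F, ∂₂F) (flip p)`: by the chain rule the
columns of `F ∘ flip` are the `J`-recombination of the columns of `F` (`det4_lincomb₃`), and the `3 × 3` determinant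
of `J` is `-(cos² 2πp₂ + sin² 2πp₂)(m₀² + m₁²)/‖m‖² = -1`. [cite: Kosinski1993, VI §6 (6.1)] -/
theorem det4_fderiv_comp_polarFlip {p : EuclideanSpace ℝ (Fin 3)} (hm : toC (L p) ∈ slitPlane)
    {F : EuclideanSpace ℝ (Fin 3) → EuclideanSpace ℝ (Fin 4)}
    (hF : DifferentiableAt ℝ F (!₂[‖L p‖ * Real.cos (2 * Real.pi * p 2), ‖L p‖ * Real.sin (2 * Real.pi * p 2),
      Complex.arg (toC (L p)) / (2 * Real.pi)])) (N : EuclideanSpace ℝ (Fin 4)) :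
    det4 N
        (fderiv ℝ (fun p' : EuclideanSpace ℝ (Fin 3) => F (!₂[‖L p'‖ * Real.cos (2 * Real.pi * p' 2),
          ‖L p'‖ * Real.sin (2 * Real.pi * p' 2), Complex.arg (toC (L p')) / (2 * Real.pi)])) p
          (EuclideanSpace.single (0 : Fin 3) (1 : ℝ)))
        (fderiv ℝ (fun p' : EuclideanSpace ℝ (Fin 3) => F (!₂[‖L p'‖ * Real.cos (2 * Real.pi * p' 2),
          ‖L p'‖ * Real.sin (2 * Real.pi * p' 2), Complex.arg (toC (L p')) / (2 * Real.pi)])) p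
          (EuclideanSpace.single (1 : Fin 3) (1 : ℝ)))
        (fderiv ℝ (fun p' : EuclideanSpace ℝ (Fin 3) => F (!₂[‖L p'‖ * Real.cos (2 * Real.pi * p' 2),
          ‖L p'‖ * Real.sin (2 * Real.pi * p' 2), Complex.arg (toC (L p')) / (2 * Real.pi)])) p
          (EuclideanSpace.single (2 : Fin 3) (1 : ℝ))) =
      - det4 N
        (fderiv ℝ F (!₂[‖L p‖ * Real.cos (2 * Real.pi * p 2), ‖L p‖ * Real.sin (2 * Real.pi * p 2),
          Complex.arg (toC (L p)) / (2 * Real.pi)]) (EuclideanSpace.single (0 : Fin 3) (1 : ℝ)))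
        (fderiv ℝ F (!₂[‖L p‖ * Real.cos (2 * Real.pi * p 2), ‖L p‖ * Real.sin (2 * Real.pi * p 2),
          Complex.arg (toC (L p)) / (2 * Real.pi)]) (EuclideanSpace.single (1 : Fin 3) (1 : ℝ)))
        (fderiv ℝ F (!₂[‖L p‖ * Real.cos (2 * Real.pi * p 2), ‖L p‖ * Real.sin (2 * Real.pi * p 2),
          Complex.arg (toC (L p)) / (2 * Real.pi)]) (EuclideanSpace.single (2 : Fin 3) (1 : ℝ))) := by
  have hm0 : L p ≠ 0 := fun h0 => slitPlane_ne_zero hm (by rw [h0]; rfl)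
  have hρ : 0 < ‖L p‖ := norm_pos_iff.2 hm0
  have hJ := hasFDerivAt_polarFlip (L := L) hm
  set q : EuclideanSpace ℝ (Fin 3) := !₂[‖L p‖ * Real.cos (2 * Real.pi * p 2), ‖L p‖ * Real.sin (2 * Real.pi * p 2),
    Complex.arg (toC (L p)) / (2 * Real.pi)] with hq
  set ρ := ‖L p‖ with hρ_def
  set co := Real.cos (2 * Real.pi * p 2) with hco
  set si := Real.sin (2 * Real.pi * p 2) with hsi
  set f₀ : EuclideanSpace ℝ (Fin 3) →L[ℝ] ℝ := (co / ρ) • (innerSL ℝ (L p)).comp L -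
    (2 * Real.pi * ρ * si) • EuclideanSpace.proj (𝕜 := ℝ) (2 : Fin 3) with hf₀
  set f₁ : EuclideanSpace ℝ (Fin 3) →L[ℝ] ℝ := (si / ρ) • (innerSL ℝ (L p)).comp L +
    (2 * Real.pi * ρ * co) • EuclideanSpace.proj (𝕜 := ℝ) (2 : Fin 3) with hf₁
  set f₂ : EuclideanSpace ℝ (Fin 3) →L[ℝ] ℝ := ((2 * Real.pi)⁻¹ • ((Complex.imCLM.comp ((toC (L p))⁻¹ • (1 : ℂ →L[ℝ] ℂ))).comp
    (Complex.orthonormalBasisOneI.repr.symm.toContinuousLinearEquiv : EuclideanSpace ℝ (Fin 2) →L[ℝ] ℂ))).comp L with hf₂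
  set e₀ : EuclideanSpace ℝ (Fin 3) := EuclideanSpace.single (0 : Fin 3) (1 : ℝ) with he₀
  set e₁ : EuclideanSpace ℝ (Fin 3) := EuclideanSpace.single (1 : Fin 3) (1 : ℝ) with he₁
  set e₂ : EuclideanSpace ℝ (Fin 3) := EuclideanSpace.single (2 : Fin 3) (1 : ℝ) with he₂
  set J : EuclideanSpace ℝ (Fin 3) →L[ℝ] EuclideanSpace ℝ (Fin 3) := f₀.smulRight e₀ + f₁.smulRight e₁ + f₂.smulRight e₂ with hJ_def
  have hcomp : HasFDerivAt (fun p' : EuclideanSpace ℝ (Fin 3) => F (!₂[‖L p'‖ * Real.cos (2 * Real.pi * p' 2),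
      ‖L p'‖ * Real.sin (2 * Real.pi * p' 2), Complex.arg (toC (L p')) / (2 * Real.pi)])) ((fderiv ℝ F q).comp J) p :=
    hF.hasFDerivAt.comp p hJ
  rw [hcomp.fderiv]
  have hJv : ∀ v, J v = f₀ v • e₀ + f₁ v • e₁ + f₂ v • e₂ := fun v => by
    simp only [hJ_def, _root_.add_apply, ContinuousLinearMap.smulRight_apply]
  have hcol : ∀ v, (fderiv ℝ F q).comp J v =
      f₀ v • fderiv ℝ F q e₀ + f₁ v • fderiv ℝ F q e₁ + f₂ v • fderiv ℝ F q e₂ := fun v => by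
    rw [ContinuousLinearMap.comp_apply, hJv, map_add, map_add, map_smul, map_smul, map_smul]
  rw [hcol e₀, hcol e₁, hcol e₂, det4_lincomb₃]
  -- the nine entries of `J`
  have hin0 : inner ℝ (L p) planeE0 = L p 0 := by simp [planeE0, EuclideanSpace.inner_single_right]
  have hin1 : inner ℝ (L p) planeE1 = L p 1 := by simp [planeE1, EuclideanSpace.inner_single_right]
  have x1 : f₀ e₀ = co / ρ * L p 0 := by
    simp only [hf₀, he₀, _root_.sub_apply, _root_.smul_apply, ContinuousLinearMap.comp_apply, innerSL_apply_apply,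
      lam_basis_zero hL, hin0, smul_eq_mul]
    simp
  have x2 : f₁ e₀ = si / ρ * L p 0 := by
    simp only [hf₁, he₀, _root_.add_apply, _root_.smul_apply, ContinuousLinearMap.comp_apply, innerSL_apply_apply,
      lam_basis_zero hL, hin0, smul_eq_mul]
    simp
  have hS : L p 0 ^ 2 + L p 1 ^ 2 = ρ ^ 2 := by rw [hρ_def, EuclideanSpace.real_norm_sq_eq, Fin.sum_univ_two]
  have x3 : f₂ e₀ = -(L p 1) / (2 * Real.pi * ρ ^ 2) := by
    rw [hf₂, he₀, ContinuousLinearMap.comp_apply, lam_basis_zero hL, argToC_fderiv_apply, hS]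
    simp [planeE0]
  have y1 : f₀ e₁ = co / ρ * L p 1 := by
    simp only [hf₀, he₁, _root_.sub_apply, _root_.smul_apply, ContinuousLinearMap.comp_apply, innerSL_apply_apply,
      lam_basis_one hL, hin1, smul_eq_mul]
    simp
  have y2 : f₁ e₁ = si / ρ * L p 1 := by
    simp only [hf₁, he₁, _root_.add_apply, _root_.smul_apply, ContinuousLinearMap.comp_apply, innerSL_apply_apply,
      lam_basis_one hL, hin1, smul_eq_mul]
    simp
  have y3 : f₂ e₁ = L p 0 / (2 * Real.pi * ρ ^ 2) := by
    rw [hf₂, he₁, ContinuousLinearMap.comp_apply, lam_basis_one hL, argToC_fderiv_apply, hS]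
    simp [planeE1]
  have z1 : f₀ e₂ = -(2 * Real.pi * ρ * si) := by
    simp only [hf₀, he₂, _root_.sub_apply, _root_.smul_apply, ContinuousLinearMap.comp_apply, innerSL_apply_apply,
      lam_basis_two hL, inner_zero_right, smul_eq_mul]
    simp
  have z2 : f₁ e₂ = 2 * Real.pi * ρ * co := by
    simp only [hf₁, he₂, _root_.add_apply, _root_.smul_apply, ContinuousLinearMap.comp_apply, innerSL_apply_apply,
      lam_basis_two hL, inner_zero_right, smul_eq_mul]
    simp
  have z3 : f₂ e₂ = 0 := by
    rw [hf₂, he₂, ContinuousLinearMap.comp_apply, lam_basis_two hL, map_zero]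
  rw [x1, x2, x3, y1, y2, y3, z1, z2, z3]
  have hcs : co ^ 2 + si ^ 2 = 1 := by rw [hco, hsi]; exact Real.cos_sq_add_sin_sq _
  have key := polarFlip_det co si ρ (L p 0) (L p 1) hρ.ne' hcs hS
  linear_combination (det4 N (fderiv ℝ F q e₀) (fderiv ℝ F q e₁) (fderiv ℝ F q e₂)) * key


end Flip

/-! ## §4 The registered package -/

/-- **Sub-goal `helper_det4_polarFlip` of stub `stub_T3_dualPresentation`** (T3 ▸ HB = `helper_Hgap_twisting` ▸
transfer step (R6c), tube side; wave 7, lead c5, worker H2): **the polar flip of `ℝ³` reverses the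
`det4`-orientation character** — for `F : ℝ³ → ℝ⁴` differentiable at `flip p` and `N ∈ ℝ⁴`,
`det4 (N, ∂(F ∘ flip)) (p) = - det4 (N, ∂F) (flip p)`, `flip (p) = (‖L p‖ cos 2πp₂, ‖L p‖ sin 2πp₂, arg (toC (L p)) / 2π)`
(the `or(flip) = -1` of the transfer `σ̂ = -s₀ ε`). [cite: Kosinski1993, VI §6 (6.1)] -/
theorem helper_det4_polarFlip : ∀ (L : EuclideanSpace ℝ (Fin 3) →L[ℝ] EuclideanSpace ℝ (Fin 2)), (∀ (p : EuclideanSpace ℝ (Fin 3)) (i : Fin 2), L p i = p (Fin.castSucc i)) → ∀ (p : EuclideanSpace ℝ (Fin 3)) (F : EuclideanSpace ℝ (Fin 3) → EuclideanSpace ℝ (Fin 4)) (N : EuclideanSpace ℝ (Fin 4)), Literature.Topology.FourManifolds.toC (L p) ∈ Complex.slitPlane → DifferentiableAt ℝ F (!₂[‖L p‖ * Real.cos (2 * Real.pi * p 2), ‖L p‖ * Real.sin (2 * Real.pi * p 2), Complex.arg (Literature.Topology.FourManifolds.toC (L p)) / (2 * Real.pi)] : EuclideanSpace ℝ (Fin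 3)) → Literature.Geometry.Symplectic.det4 N (fderiv ℝ (fun p' : EuclideanSpace ℝ (Fin 3) => F (!₂[‖L p'‖ * Real.cos (2 * Real.pi * p' 2), ‖L p'‖ * Real.sin (2 * Real.pi * p' 2), Complex.arg (Literature.Topology.FourManifolds.toC (L p')) / (2 * Real.pi)] : EuclideanSpace ℝ (Fin 3))) p (EuclideanSpace.single (0 : Fin 3) (1 : ℝ))) (fderiv ℝ (fun p' : EuclideanSpace ℝ (Fin 3) => F (!₂[‖L p'‖ * Real.cos (2 * Real.pi * p' 2), ‖L p'‖ * Real.sin (2 * Real.pi * p' 2), Complex.arg (Literature.Topology.FourManifolds.toC (L p')) / (2 * Real.pi)] : EuclideanSpace ℝ (Fin 3))) p (EuclideanSpace.single (1 : Fin 3) (1 : ℝ))) (fderiv ℝ (fun p' : EuclideanSpace ℝ (Fin 3) => F (!₂[‖L p'‖ * Real.cos (2 * Real.pi * p' 2), ‖L p'‖ * Real.sin (2 * Real.pi * p' 2), Complex.arg (Literature.Topology.FourManifolds.toC (L p')) / (2 * Real.pi)] : EuclideanSpace ℝ (Fin 3))) p (EuclideanSpace.single (2 : Fin 3) (1 :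 ℝ))) = - Literature.Geometry.Symplectic.det4 N (fderiv ℝ F (!₂[‖L p‖ * Real.cos (2 * Real.pi * p 2), ‖L p‖ * Real.sin (2 * Real.pi * p 2), Complex.arg (Literature.Topology.FourManifolds.toC (L p)) / (2 * Real.pi)] : EuclideanSpace ℝ (Fin 3)) (EuclideanSpace.single (0 : Fin 3) (1 : ℝ))) (fderiv ℝ F (!₂[‖L p‖ * Real.cos (2 * Real.pi * p 2), ‖L p‖ * Real.sin (2 * Real.pi * p 2), Complex.arg (Literature.Topology.FourManifolds.toC (L p)) / (2 * Real.pi)] : EuclideanSpace ℝ (Fin 3)) (EuclideanSpace.single (1 : Fin 3) (1 : ℝ))) (fderiv ℝ F (!₂[‖L p‖ * Real.cos (2 * Real.pi * p 2), ‖L p‖ * Real.sin (2 * Real.pi * p 2), Complex.arg (Literature.Topology.FourManifolds.toC (L p)) / (2 * Real.pi)] : EuclideanSpace ℝ (Fin 3)) (EuclideanSpace.single (2 : Fin 3) (1 : ℝ))) :=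
  fun _ hL _ _ N hm hF => det4_fderiv_comp_polarFlip hL hm hF N

end Summit.SmoothPoincare4.SmoothPoincare4.Theorems.AcyclicBisectionExists.ModpBraidOrbits

end
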